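import Literature.Analysis.UnboundedOperators.HeatKernelFourier
import Mathlib.Analysis.Fourier.Inversion
import Mathlib.Analysis.SpecialFunctions.Gamma.Basic
import Mathlib.Analysis.SpecialFunctions.Gaussian.GaussianIntegral
import Mathlib.MeasureTheory.Integral.ExpDecay
import HarnessLib

/-!
# The Coulomb energy in momentum space: `∫|f̂(p)|²/(4π²|p|²)dp = ∬f(x)f(y)/(4π|x-y|)dxdy`

Topic `Literature/MathematicalPhysics/QuantumManyBody` (provefact
`Literature.MathematicalPhysics.QuantumManyBody.BoseGas.Fournais2020_condensation`, layer `Fournais2020_lemma24`,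
input `Fournais2020_eq242` = [Fournais2020, (2.42) with (A.6)]). The printed step
"`(2π)⁻³∫Ŵ₁(p)²/(2p²)dp = ∬W₁(x)W₁(y)/(2|x-y|)dxdy`" (the normalisation in print is loose; with
`𝓕(|x|⁻¹)(k) = 4π/k²` one has `(2π)⁻³∫|f̂(k)|²k⁻²dk = ∬f(x)f(y)/(4π|x-y|)`) is the classical
identity between the Coulomb energy of a charge density and the weighted `L²` norm of its Fourier
transform. For the merely integrable, non-negative densities of the application (`W₁ ≤ 2v`,
`v ∈ L¹`) neither side need be finite and `f̂ ∉ L²` in general, so Plancherel is not available;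
this file proves the identity in `[0, ∞]` by Gaussian subordination, in Mathlib's convention
`𝓕f(p) = ∫e^{-2πi⟨x,p⟩}f(x)dx` (`k = 2πp`):

* `integral_heatSymbol_mul_normSq_fourier` — for real `f ∈ L¹(V)` and `s > 0`,
  `∫ e^{-4π²s|p|²}|f̂(p)|²dp = ∬ f(x)f(y)G_s(x-y)dxdy` with `G_s` the Gauss–Weierstrass kernel
  (`UnboundedOperators/HeatKernel`, `𝓕G_s = e^{-4π²s|·|²}`): `|f̂|² = 𝓕⁻f·𝓕f` is an absolutely
  convergent triple integral against the Gaussian, Fubini, and Fourier inversion for `G_s`;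
* `integral_Ioi_heatSymbol`, `integral_Ioi_heatKernel` — the subordination identities
  `∫₀^∞ e^{-4π²s|p|²}ds = (4π²|p|²)⁻¹` and, on `ℝ³`, `∫₀^∞ G_s(z)ds = (4π|z|)⁻¹` (substitution
  `s = |z|²/(4y)`, `Γ(½) = √π`);
* `lintegral_normSq_fourier_div_eq` — **`∫|f̂(p)|²(4π²|p|²)⁻¹dp = ∬f(x)f(y)(4π|x-y|)⁻¹dxdy` in
  `ℝ≥0∞`** for `f ≥ 0` measurable and integrable on `ℝ³` (Tonelli over `s`).

No new definitions.

## References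

* [Fournais2020] S. Fournais, *Length scales for BEC in the dilute Bose gas*, arXiv:2011.00309,
  EMS Ser. Congr. Rep. 18 (2021), doi:10.4171/ecr/18-1/7: (2.42), App. A (A.6).
* [LiebLoss2001] E. H. Lieb, M. Loss, *Analysis*, 2nd ed., AMS 2001: Thm. 5.9 (`𝓕|x|^{α-n}`) and
  §9.8 (positivity of the Coulomb energy), for the classical statement.
* E. M. Stein, *Singular integrals and differentiability properties of functions* (1970),
  Ch. III §2.1 (Gaussian subordination), Ch. V §1 (Riesz potentials).
-/

noncomputable section

open MeasureTheory Set Filter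
open scoped ENNReal NNReal FourierTransform ComplexConjugate RealInnerProductSpace Real Topology
open Literature.Analysis.UnboundedOperators

namespace Literature.MathematicalPhysics.QuantumManyBody.BoseGas

/-! ### The Gaussian-regularised identity `∫ e^{-4π²s|p|²}|f̂(p)|² dp = ∬ f(x)f(y)G_s(x-y)` -/

section Gaussian

variable {V : Type*} [NormedAddCommGroup V] [InnerProductSpace ℝ V] [FiniteDimensional ℝ V]
  [MeasurableSpace V] [BorelSpace V]

/-- The heat symbol `e^{-4π²s|p|²}` is integrable for `s > 0` (it is a Gaussian). [folklore] -/
theorem integrable_heatSymbol {s : ℝ} (hs : 0 < s) : Integrable (fun p : V => heatSymbol s p) := by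
  have hb : 0 < (2 * π) ^ 2 * s := by positivity
  have hint : Integrable (fun p : V => Real.exp (-((2 * π) ^ 2 * s) * ‖p‖ ^ 2)) := by
    by_contra h
    have h1 := GaussianFourier.integral_rexp_neg_mul_sq_norm (V := V) hb
    rw [integral_undef h] at h1
    have : 0 < (π / ((2 * π) ^ 2 * s)) ^ ((Module.finrank ℝ V : ℝ) / 2) := by positivity
    exact this.ne h1
  refine hint.congr (Eventually.of_forall fun p => ?_)
  simp only [heatSymbol]
  ring_nf

/-- `conj f̂(p) = 𝓕⁻f(p)` for a real-valued `f`. [folklore] -/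
theorem conj_fourier_ofReal (f : V → ℝ) (p : V) :
    conj (𝓕 (fun x => (f x : ℂ)) p) = 𝓕⁻ (fun x => (f x : ℂ)) p := by
  rw [Real.fourier_eq, Real.fourierInv_eq, ← integral_conj]
  congr 1
  funext v
  rw [Circle.smul_def, Circle.smul_def, smul_eq_mul, smul_eq_mul, map_mul, Complex.conj_ofReal,
    ← Circle.coe_inv_eq_conj, ← AddChar.map_neg_eq_inv, neg_neg]

/-- `𝓕⁻(e^{-4π²s|·|²}) = G_s`, the Gauss–Weierstrass kernel (Fourier inversion of
`𝓕G_s = e^{-4π²s|p|²}`). [folklore] -/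
theorem fourierInv_heatSymbol {s : ℝ} (hs : 0 < s) :
    𝓕⁻ (fun p : V => (heatSymbol s p : ℂ)) = fun x => (heatKernel s x : ℂ) := by
  have hFG : 𝓕 (fun x : V => (heatKernel s x : ℂ)) = fun p => (heatSymbol s p : ℂ) :=
    funext fun p => fourierIntegral_heatKernel_holds hs p
  have hc : Continuous fun x : V => (heatKernel s x : ℂ) := Complex.continuous_ofReal.comp (continuous_heatKernel s)
  have hi : Integrable (fun x : V => (heatKernel s x : ℂ)) := (integrable_heatKernel_holds hs).ofReal
  have hi' : Integrable (𝓕 fun x : V => (heatKernel s x : ℂ)) := by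
    rw [hFG]; exact (integrable_heatSymbol hs).ofReal
  rw [← hFG]
  exact hc.fourierInv_fourier_eq hi hi'

/-- **`∫ e^{-4π²s|p|²} |f̂(p)|² dp = ∬ f(x) f(y) G_s(x - y) dx dy`** for a real `f ∈ L¹` and
`s > 0` (`G_s` the heat kernel): `|f̂|² = 𝓕⁻f · 𝓕f` is a double integral of
`f(x)f(y)e^{2πi⟨x-y,p⟩}`, absolutely convergent against the Gaussian, and Fubini leaves
`𝓕⁻(e^{-4π²s|·|²})(x - y) = G_s(x - y)`. (The Plancherel-free form of
`⟨f, G_s * f⟩ = ∫ Ĝ_s |f̂|²`.) [folklore] -/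
theorem integral_heatSymbol_mul_normSq_fourier {f : V → ℝ} (hfm : Measurable f) (hf : Integrable f)
    {s : ℝ} (hs : 0 < s) :
    ∫ p, heatSymbol s p * ‖𝓕 (fun x => (f x : ℂ)) p‖ ^ 2 =
      ∫ x, ∫ y, f x * f y * heatKernel s (x - y) := by
  set F : V → ℂ := fun x => (f x : ℂ) with hFdef
  have hFm : Measurable F := Complex.measurable_ofReal.comp hfm
  have hsym := integrable_heatSymbol (V := V) hs
  have hGb : ∀ z : V, |heatKernel s z| ≤ (4 * π * s) ^ (-(Module.finrank ℝ V : ℝ) / 2) := fun z => by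
    rw [abs_of_pos (heatKernel_pos hs z)]
    exact heatKernel_le hs z
  -- the integrand of the triple integral
  set Φ : V → V × V → ℂ := fun p z =>
    (heatSymbol s p : ℂ) * ((𝐞 ⟪z.1, p⟫ : ℂ) * F z.1 * ((𝐞 (-⟪z.2, p⟫) : ℂ) * F z.2)) with hΦdef
  have hΦn : ∀ p z, ‖Φ p z‖ = heatSymbol s p * (‖f z.1‖ * ‖f z.2‖) := by
    intro p z
    simp only [hΦdef, hFdef, norm_mul, Complex.norm_real, Circle.norm_coe, one_mul, Real.norm_eq_abs,
      abs_of_pos (heatSymbol_pos s p)]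
  have hΦm : Measurable (Function.uncurry Φ) := by
    have h1 : Measurable fun q : V × (V × V) => (heatSymbol s q.1 : ℂ) :=
      Complex.measurable_ofReal.comp ((by unfold heatSymbol; fun_prop : Continuous fun p : V => heatSymbol s p).measurable.comp measurable_fst)
    have h2 : Measurable fun q : V × (V × V) => (𝐞 ⟪q.2.1, q.1⟫ : ℂ) :=
      (continuous_subtype_val.comp (Real.continuous_fourierChar.comp (by fun_prop))).measurable
    have h3 : Measurable fun q : V × (V × V) => (𝐞 (-⟪q.2.2, q.1⟫) : ℂ) :=
      (continuous_subtype_val.comp (Real.continuous_fourierChar.comp (by fun_prop))).measurable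
    have h4 : Measurable fun q : V × (V × V) => F q.2.1 := hFm.comp (measurable_fst.comp measurable_snd)
    have h5 : Measurable fun q : V × (V × V) => F q.2.2 := hFm.comp (measurable_snd.comp measurable_snd)
    exact h1.mul ((h2.mul h4).mul (h3.mul h5))
  have hΦi : Integrable (Function.uncurry Φ) ((volume : Measure V).prod ((volume : Measure V).prod volume)) := by
    have hb : Integrable (fun q : V × (V × V) => heatSymbol s q.1 * (‖f q.2.1‖ * ‖f q.2.2‖))
        ((volume : Measure V).prod ((volume : Measure V).prod volume)) :=
      hsym.mul_prod (hf.norm.mul_prod hf.norm)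
    refine hb.mono' hΦm.aestronglyMeasurable (Eventually.of_forall fun q => ?_)
    rw [Function.uncurry_apply_pair] at *
    exact (hΦn q.1 q.2).le
  -- Step 1: the left-hand side as `∫_p ∫_z Φ`
  have hL : ((∫ p, heatSymbol s p * ‖𝓕 F p‖ ^ 2 : ℝ) : ℂ) = ∫ p, ∫ z, Φ p z ∂((volume : Measure V).prod volume) := by
    rw [← integral_complex_ofReal]
    refine integral_congr_ae (Eventually.of_forall fun p => ?_)
    simp only
    rw [Complex.ofReal_mul, Complex.ofReal_pow, ← Complex.conj_mul', conj_fourier_ofReal, Real.fourierInv_eq,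
      Real.fourier_eq, ← integral_prod_mul, ← integral_const_mul]
    refine integral_congr_ae (Eventually.of_forall fun z => ?_)
    simp only [hΦdef, hFdef, Circle.smul_def, smul_eq_mul]
  -- Step 2: Fubini
  have hswap : ∫ p, ∫ z, Φ p z ∂((volume : Measure V).prod volume) =
      ∫ z, ∫ p, Φ p z ∂(volume : Measure V) ∂((volume : Measure V).prod volume) :=
    integral_integral_swap hΦi
  -- Step 3: the inner `p`-integral is `f(x) f(y) 𝓕⁻(ĥ)(x - y) = f(x) f(y) G_s(x - y)`
  have hinner : ∀ z : V × V, ∫ p, Φ p z = F z.1 * F z.2 * (heatKernel s (z.1 - z.2) : ℂ) := by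
    intro z
    have h1 : ∀ p : V, Φ p z = F z.1 * F z.2 * ((𝐞 ⟪p, z.1 - z.2⟫ : Circle) • (heatSymbol s p : ℂ)) := by
      intro p
      simp only [hΦdef, Circle.smul_def, smul_eq_mul]
      have : (𝐞 ⟪z.1, p⟫ : ℂ) * (𝐞 (-⟪z.2, p⟫) : ℂ) = (𝐞 ⟪p, z.1 - z.2⟫ : ℂ) := by
        rw [← Circle.coe_mul, ← AddChar.map_add_eq_mul, inner_sub_right, real_inner_comm p z.1,
          real_inner_comm p z.2, sub_eq_add_neg]
      rw [← this]
      ring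
    simp_rw [h1]
    rw [integral_const_mul, ← Real.fourierInv_eq, fourierInv_heatSymbol hs]
  simp_rw [hinner] at hswap
  -- Step 4: back to an iterated real integral
  have hprod : Integrable (fun z : V × V => F z.1 * F z.2 * (heatKernel s (z.1 - z.2) : ℂ))
      ((volume : Measure V).prod volume) := by
    have hb : Integrable (fun z : V × V => ‖f z.1‖ * (‖f z.2‖ * (4 * π * s) ^ (-(Module.finrank ℝ V : ℝ) / 2)))
        ((volume : Measure V).prod volume) := hf.norm.mul_prod (hf.norm.mul_const _)
    refine hb.mono' ?_ (Eventually.of_forall fun z => ?_)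
    · exact ((hFm.comp measurable_fst).mul (hFm.comp measurable_snd)).mul
        (Complex.measurable_ofReal.comp ((continuous_heatKernel s).measurable.comp
          (measurable_fst.sub measurable_snd))) |>.aestronglyMeasurable
    · simp only [norm_mul, hFdef, Complex.norm_real, Real.norm_eq_abs]
      rw [mul_assoc]
      gcongr
      exact hGb _
  have hR : ∫ z, F z.1 * F z.2 * (heatKernel s (z.1 - z.2) : ℂ) ∂((volume : Measure V).prod volume) =
      ((∫ x, ∫ y, f x * f y * heatKernel s (x - y) : ℝ) : ℂ) := by
    rw [integral_prod _ hprod, ← integral_complex_ofReal]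
    refine integral_congr_ae (Eventually.of_forall fun x => ?_)
    simp only
    rw [← integral_complex_ofReal]
    refine integral_congr_ae (Eventually.of_forall fun y => ?_)
    simp only [hFdef]
    push_cast
    ring
  exact_mod_cast hL.trans (hswap.trans hR)

end Gaussian

/-! ### Subordination: `∫₀^∞ e^{-4π²s|p|²} ds = 1/(4π²|p|²)` and `∫₀^∞ G_s(z) ds = 1/(4π|z|)` -/

section Subordination

variable {V : Type*} [NormedAddCommGroup V]

/-- `∫₀^∞ e^{-4π²s|p|²} ds = (4π²|p|²)⁻¹` for `p ≠ 0`. [folklore] -/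
theorem integral_Ioi_heatSymbol {p : V} (hp : p ≠ 0) :
    ∫ s in Ioi (0 : ℝ), heatSymbol s p = ((2 * π) ^ 2 * ‖p‖ ^ 2)⁻¹ := by
  have hc : 0 < (2 * π) ^ 2 * ‖p‖ ^ 2 := by
    have := norm_pos_iff.2 hp
    positivity
  have h1 : ∀ s : ℝ, heatSymbol s p = (fun x => Real.exp (-x)) ((2 * π) ^ 2 * ‖p‖ ^ 2 * s) := by
    intro s
    simp only [heatSymbol]
    ring_nf
  simp_rw [h1]
  rw [integral_comp_mul_left_Ioi (fun x => Real.exp (-x)) 0 hc, mul_zero, integral_exp_neg_Ioi_zero,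
    smul_eq_mul, mul_one]

/-- `s ↦ e^{-4π²s|p|²}` is integrable on `(0, ∞)` for `p ≠ 0`. [folklore] -/
theorem integrableOn_Ioi_heatSymbol {p : V} (hp : p ≠ 0) :
    IntegrableOn (fun s : ℝ => heatSymbol s p) (Ioi 0) := by
  have hc : 0 < (2 * π) ^ 2 * ‖p‖ ^ 2 := by
    have := norm_pos_iff.2 hp
    positivity
  refine (exp_neg_integrableOn_Ioi 0 hc).congr_fun (fun s _ => ?_) measurableSet_Ioi
  simp only [heatSymbol]
  ring_nf

/-- `∫₀^∞ e^{-4π²s|p|²} ds = (4π²|p|²)⁻¹` in `ℝ≥0∞`, for `p ≠ 0`. [folklore] -/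
theorem lintegral_Ioi_heatSymbol {p : V} (hp : p ≠ 0) :
    ∫⁻ s in Ioi (0 : ℝ), ENNReal.ofReal (heatSymbol s p) = ENNReal.ofReal (((2 * π) ^ 2 * ‖p‖ ^ 2)⁻¹) := by
  rw [← integral_Ioi_heatSymbol hp, ofReal_integral_eq_lintegral_ofReal (integrableOn_Ioi_heatSymbol hp)
    (Eventually.of_forall fun s => (heatSymbol_pos s p).le)]

/-- The heat kernel of `ℝ³`: `G_s(z) = (4πs)^{-3/2} e^{-|z|²/(4s)}`. [folklore] -/
theorem heatKernel_three (s : ℝ) (z : EuclideanSpace ℝ (Fin 3)) :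
    heatKernel s z = (4 * π * s) ^ (-(3 / 2 : ℝ)) * Real.exp (-‖z‖ ^ 2 / (4 * s)) := by
  rw [heatKernel, finrank_euclideanSpace_fin]
  norm_num

/-- **`∫₀^∞ G_s(z) ds = (4π|z|)⁻¹`** on `ℝ³` for `z ≠ 0` (the Newtonian kernel is subordinated to the
heat kernel; substitution `s = |z|²/(4y)` and `Γ(½) = √π`). [folklore] -/
theorem integral_Ioi_heatKernel {z : EuclideanSpace ℝ (Fin 3)} (hz : z ≠ 0) :
    ∫ s in Ioi (0 : ℝ), heatKernel s z = (4 * π * ‖z‖)⁻¹ := by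
  have hr : 0 < ‖z‖ := norm_pos_iff.2 hz
  set r : ℝ := ‖z‖ with hr_def
  set c : ℝ := r ^ 2 / 4 with hc
  have hc0 : 0 < c := by positivity
  -- scaling `s = c x`
  have h1 : ∫ s in Ioi (0 : ℝ), heatKernel s z = c * ∫ x in Ioi (0 : ℝ), heatKernel (c * x) z := by
    have h := integral_comp_mul_left_Ioi (fun s => heatKernel s z) 0 hc0
    simp only [mul_zero, smul_eq_mul] at h
    rw [h, ← mul_assoc, mul_inv_cancel₀ hc0.ne', one_mul]
  -- inversion `x = 1/y`
  set g : ℝ → ℝ := fun y => (y ^ 2)⁻¹ * heatKernel (c * y⁻¹) z with hg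
  have h2 : ∫ x in Ioi (0 : ℝ), heatKernel (c * x) z = ∫ y in Ioi (0 : ℝ), g y := by
    rw [← integral_comp_rpow_Ioi g (p := -1) (by norm_num)]
    refine setIntegral_congr_fun measurableSet_Ioi fun x hx => ?_
    have hx0 : 0 < x := hx
    simp only [hg, smul_eq_mul, Real.rpow_neg_one, inv_inv]
    rw [show (-1 - 1 : ℝ) = -2 by norm_num, Real.rpow_neg hx0.le, show (2 : ℝ) = ((2 : ℕ) : ℝ) by norm_num,
      Real.rpow_natCast, inv_pow]
    norm_num
    field_simp
  -- evaluation through `Γ(½)`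
  have h3 : ∀ y ∈ Ioi (0 : ℝ), g y = (4 * π * c) ^ (-(3 / 2 : ℝ)) * (Real.exp (-y) * y ^ (1 / 2 - 1 : ℝ)) := by
    intro y hy
    have hy0 : 0 < y := hy
    have e1 : -‖z‖ ^ 2 / (4 * (c * y⁻¹)) = -y := by
      rw [← hr_def, hc]
      field_simp
    have e2 : (4 * π * (c * y⁻¹)) ^ (-(3 / 2 : ℝ)) = (4 * π * c) ^ (-(3 / 2 : ℝ)) * y ^ (3 / 2 : ℝ) := by
      rw [show 4 * π * (c * y⁻¹) = (4 * π * c) * y⁻¹ by ring, Real.mul_rpow (by positivity) (by positivity),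
        Real.inv_rpow hy0.le, Real.rpow_neg hy0.le, inv_inv]
    have e3 : (y ^ 2)⁻¹ * y ^ (3 / 2 : ℝ) = y ^ (1 / 2 - 1 : ℝ) := by
      rw [show (y ^ 2)⁻¹ = y ^ (-2 : ℝ) by
        rw [Real.rpow_neg hy0.le, show (2 : ℝ) = ((2 : ℕ) : ℝ) by norm_num, Real.rpow_natCast],
        ← Real.rpow_add hy0]
      norm_num
    simp only [hg, heatKernel_three]
    rw [e1, e2, ← e3]
    ring
  have h4 : ∫ y in Ioi (0 : ℝ), g y = (4 * π * c) ^ (-(3 / 2 : ℝ)) * √π := by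
    rw [setIntegral_congr_fun measurableSet_Ioi h3, integral_const_mul,
      ← Real.Gamma_eq_integral (by norm_num : (0 : ℝ) < 1 / 2), Real.Gamma_one_half_eq]
  rw [h1, h2, h4]
  -- algebra: `c (π r²)^{-3/2} √π = (4π r)⁻¹`
  have e4 : 4 * π * c = π * r ^ 2 := by rw [hc]; ring
  have e5 : (π * r ^ 2) ^ (-(3 / 2 : ℝ)) = (π * r ^ 2 * (√π * r))⁻¹ := by
    rw [Real.rpow_neg (by positivity), show (3 / 2 : ℝ) = 1 + 1 / 2 by norm_num,
      Real.rpow_add (by positivity), Real.rpow_one, ← Real.sqrt_eq_rpow, Real.sqrt_mul Real.pi_pos.le,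
      Real.sqrt_sq hr.le]
  have hsq : 0 < √π := Real.sqrt_pos.2 Real.pi_pos
  rw [e4, e5, hc]
  field_simp

/-- `∫₀^∞ G_s(z) ds = (4π|z|)⁻¹` in `ℝ≥0∞` (with integrability of `s ↦ G_s(z)` on `(0,∞)`), `z ≠ 0`.
[folklore] -/
theorem lintegral_Ioi_heatKernel {z : EuclideanSpace ℝ (Fin 3)} (hz : z ≠ 0) :
    ∫⁻ s in Ioi (0 : ℝ), ENNReal.ofReal (heatKernel s z) = ENNReal.ofReal ((4 * π * ‖z‖)⁻¹) := by
  have hval := integral_Ioi_heatKernel hz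
  have hpos : 0 < (4 * π * ‖z‖)⁻¹ := by
    have := norm_pos_iff.2 hz
    positivity
  -- integrability follows from the non-zero value of the (junk-valued) Bochner integral
  have hint : IntegrableOn (fun s : ℝ => heatKernel s z) (Ioi 0) := by
    by_contra h
    rw [IntegrableOn] at h
    rw [integral_undef h] at hval
    exact hpos.ne hval
  have hnn : 0 ≤ᵐ[volume.restrict (Ioi (0 : ℝ))] fun s => heatKernel s z := by
    rw [EventuallyLE, ae_restrict_iff' measurableSet_Ioi]
    exact Eventually.of_forall fun s hs => (heatKernel_pos hs z).le
  rw [← hval, ofReal_integral_eq_lintegral_ofReal hint hnn]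

end Subordination

/-! ### The Coulomb energy in momentum space (Tonelli over the subordination parameter) -/

section Coulomb

/-- The squared modulus of the Fourier transform of an `L¹` function is continuous and bounded by
`‖f‖₁²`. [folklore] -/
theorem continuous_normSq_fourier {V : Type*} [NormedAddCommGroup V] [InnerProductSpace ℝ V]
    [FiniteDimensional ℝ V] [MeasurableSpace V] [BorelSpace V] {F : V → ℂ} (hF : Integrable F) :
    Continuous fun p => ‖𝓕 F p‖ ^ 2 :=
  (VectorFourier.fourierIntegral_continuous Real.continuous_fourierChar (by exact continuous_inner) hF).norm.pow 2

/-- **The Coulomb energy of a non-negative `L¹` function in momentum space**: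
`∫ |f̂(p)|²/(4π²|p|²) dp = ∬ f(x) f(y)/(4π|x - y|) dx dy` in `[0, ∞]` (both sides may be infinite),
for `f ≥ 0` measurable and integrable on `ℝ³`. Proof: write `(4π²|p|²)⁻¹ = ∫₀^∞ e^{-4π²s|p|²}ds` and
`(4π|z|)⁻¹ = ∫₀^∞ G_s(z)ds`, use the Gaussian identity `∫e^{-4π²s|p|²}|f̂|² = ∬ffG_s(x-y)` at each
`s`, and Tonelli (everything is non-negative). In Fournais' convention (`k = 2πp`) this is
`(2π)⁻³∫|f̂(k)|²/k² dk = ∬ f(x)f(y)/(4π|x-y|)`, the identity behind (2.42) and (A.6). [cite: Fournais2020, (2.42), (A.6)] -/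
theorem lintegral_normSq_fourier_div_eq {f : EuclideanSpace ℝ (Fin 3) → ℝ} (hfm : Measurable f)
    (hf : Integrable f) (hf0 : ∀ x, 0 ≤ f x) :
    ∫⁻ p, ENNReal.ofReal (‖𝓕 (fun x => (f x : ℂ)) p‖ ^ 2 * ((2 * π) ^ 2 * ‖p‖ ^ 2)⁻¹) =
      ∫⁻ x, ∫⁻ y, ENNReal.ofReal (f x * f y * (4 * π * ‖x - y‖)⁻¹) := by
  set F : EuclideanSpace ℝ (Fin 3) → ℂ := fun x => (f x : ℂ) with hFdef
  have hFi : Integrable F := hf.ofReal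
  have hΦc : Continuous fun p => ‖𝓕 F p‖ ^ 2 := continuous_normSq_fourier hFi
  have hΦb : ∀ p, ‖𝓕 F p‖ ^ 2 ≤ (∫ x, ‖F x‖) ^ 2 := fun p => by
    gcongr
    exact VectorFourier.norm_fourierIntegral_le_integral_norm _ _ _ _ _
  -- joint measurability of the symbol and the kernel in `(s, ·)`
  have hsym_m : Measurable fun q : ℝ × EuclideanSpace ℝ (Fin 3) => heatSymbol q.1 q.2 := by
    unfold heatSymbol; fun_prop
  have hker_m : Measurable fun q : ℝ × EuclideanSpace ℝ (Fin 3) => heatKernel q.1 q.2 := by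
    have : (fun q : ℝ × EuclideanSpace ℝ (Fin 3) => heatKernel q.1 q.2) =
        fun q => (4 * π * q.1) ^ (-(3 / 2 : ℝ)) * Real.exp (-‖q.2‖ ^ 2 / (4 * q.1)) := funext fun q => heatKernel_three q.1 q.2
    rw [this]
    exact ((measurable_const.mul measurable_fst).pow_const _).mul (by fun_prop)
  -- Step 1: insert `(4π²|p|²)⁻¹ = ∫₀^∞ ĥ_s(p) ds` (off the null set `p = 0`)
  have hae0 : ∀ᵐ p ∂(volume : Measure (EuclideanSpace ℝ (Fin 3))), p ≠ 0 := by
    have : (volume : Measure (EuclideanSpace ℝ (Fin 3))) {p | ¬p ≠ 0} = 0 := by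
      simp only [ne_eq, not_not, setOf_eq_eq_singleton, measure_singleton]
    exact ae_iff.2 this
  have step1 : ∫⁻ p, ENNReal.ofReal (‖𝓕 F p‖ ^ 2 * ((2 * π) ^ 2 * ‖p‖ ^ 2)⁻¹) =
      ∫⁻ p, ∫⁻ s in Ioi (0 : ℝ), ENNReal.ofReal (heatSymbol s p * ‖𝓕 F p‖ ^ 2) := by
    refine lintegral_congr_ae ?_
    filter_upwards [hae0] with p hp
    rw [ENNReal.ofReal_mul (sq_nonneg _), ← lintegral_Ioi_heatSymbol hp, ← lintegral_const_mul' _ _ ENNReal.ofReal_ne_top]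
    refine lintegral_congr fun s => ?_
    rw [← ENNReal.ofReal_mul (sq_nonneg _), mul_comm]
  -- Step 2: Tonelli in `(p, s)`
  have step2 : ∫⁻ p, ∫⁻ s in Ioi (0 : ℝ), ENNReal.ofReal (heatSymbol s p * ‖𝓕 F p‖ ^ 2) =
      ∫⁻ s in Ioi (0 : ℝ), ∫⁻ p, ENNReal.ofReal (heatSymbol s p * ‖𝓕 F p‖ ^ 2) := by
    refine lintegral_lintegral_swap ?_
    refine (ENNReal.measurable_ofReal.comp ?_).aemeasurable
    exact (hsym_m.comp measurable_swap).mul (hΦc.measurable.comp measurable_fst)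
  -- Step 3: for each `s > 0`, the Gaussian identity, written with `lintegral`s
  have step3 : ∀ s ∈ Ioi (0 : ℝ), ∫⁻ p, ENNReal.ofReal (heatSymbol s p * ‖𝓕 F p‖ ^ 2) =
      ∫⁻ x, ∫⁻ y, ENNReal.ofReal (f x * f y * heatKernel s (x - y)) := by
    intro s hs
    have hs0 : 0 < s := hs
    -- left: an integrable non-negative function
    have hLi : Integrable fun p => heatSymbol s p * ‖𝓕 F p‖ ^ 2 := by
      have h := (integrable_heatSymbol (V := EuclideanSpace ℝ (Fin 3)) hs0).bdd_mul (c := (∫ x, ‖F x‖) ^ 2)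
        hΦc.aestronglyMeasurable (Eventually.of_forall fun p => ?_)
      · exact h.congr (Eventually.of_forall fun p => mul_comm _ _)
      · rw [Real.norm_of_nonneg (sq_nonneg _)]
        exact hΦb p
    rw [← ofReal_integral_eq_lintegral_ofReal hLi (Eventually.of_forall fun p =>
      mul_nonneg (heatSymbol_pos s p).le (sq_nonneg _)), integral_heatSymbol_mul_normSq_fourier hfm hf hs0]
    -- right: the non-negative kernel `K(x, y) = f(x) f(y) G_s(x - y)` is integrable on the product
    have hGb : ∀ w : EuclideanSpace ℝ (Fin 3), |heatKernel s w| ≤ (4 * π * s) ^ (-(3 : ℝ) / 2) := fun w => by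
      rw [abs_of_pos (heatKernel_pos hs0 w)]
      have h := heatKernel_le hs0 w
      rw [finrank_euclideanSpace_fin] at h
      exact_mod_cast h
    have hK0 : ∀ x y, 0 ≤ f x * f y * heatKernel s (x - y) := fun x y =>
      mul_nonneg (mul_nonneg (hf0 x) (hf0 y)) (heatKernel_pos hs0 _).le
    have hKm : Measurable fun z : EuclideanSpace ℝ (Fin 3) × EuclideanSpace ℝ (Fin 3) =>
        f z.1 * f z.2 * heatKernel s (z.1 - z.2) :=
      ((hfm.comp measurable_fst).mul (hfm.comp measurable_snd)).mul
        ((continuous_heatKernel s).measurable.comp (measurable_fst.sub measurable_snd))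
    have hKi : Integrable (fun z : EuclideanSpace ℝ (Fin 3) × EuclideanSpace ℝ (Fin 3) =>
        f z.1 * f z.2 * heatKernel s (z.1 - z.2)) (volume.prod volume) := by
      have hb : Integrable (fun z : EuclideanSpace ℝ (Fin 3) × EuclideanSpace ℝ (Fin 3) =>
          ‖f z.1‖ * (‖f z.2‖ * (4 * π * s) ^ (-(3 : ℝ) / 2))) (volume.prod volume) :=
        hf.norm.mul_prod (hf.norm.mul_const _)
      refine hb.mono' hKm.aestronglyMeasurable (Eventually.of_forall fun z => ?_)
      rw [Real.norm_eq_abs, abs_mul, abs_mul, mul_assoc, ← Real.norm_eq_abs, ← Real.norm_eq_abs]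
      gcongr
      exact hGb _
    have hx_int : ∀ x, Integrable (fun y => f x * f y * heatKernel s (x - y)) := by
      intro x
      have hb : Integrable fun y => ‖f y‖ * (|f x| * (4 * π * s) ^ (-(3 : ℝ) / 2)) := hf.norm.mul_const _
      refine hb.mono' (hKm.comp (measurable_const.prodMk measurable_id)).aestronglyMeasurable
        (Eventually.of_forall fun y => ?_)
      rw [Real.norm_eq_abs, abs_mul, abs_mul, Real.norm_eq_abs]
      calc |f x| * |f y| * |heatKernel s (x - y)| = |f y| * (|f x| * |heatKernel s (x - y)|) := by ring
        _ ≤ |f y| * (|f x| * (4 * π * s) ^ (-(3 : ℝ) / 2)) := by gcongr; exact hGb _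
    rw [ofReal_integral_eq_lintegral_ofReal hKi.integral_prod_left
      (Eventually.of_forall fun x => integral_nonneg fun y => hK0 x y)]
    refine lintegral_congr fun x => ?_
    exact ofReal_integral_eq_lintegral_ofReal (hx_int x) (Eventually.of_forall fun y => hK0 x y)
  -- Step 4: Tonelli in `(s, x)` and `(s, y)`, then the subordination of the Newton kernel
  have hJ : Measurable fun q : ℝ × (EuclideanSpace ℝ (Fin 3) × EuclideanSpace ℝ (Fin 3)) =>
      ENNReal.ofReal (f q.2.1 * f q.2.2 * heatKernel q.1 (q.2.1 - q.2.2)) := by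
    refine ENNReal.measurable_ofReal.comp ?_
    refine ((hfm.comp (measurable_fst.comp measurable_snd)).mul (hfm.comp (measurable_snd.comp measurable_snd))).mul ?_
    exact hker_m.comp (measurable_fst.prodMk ((measurable_fst.comp measurable_snd).sub (measurable_snd.comp measurable_snd)))
  have step4 : ∫⁻ s in Ioi (0 : ℝ), ∫⁻ x, ∫⁻ y, ENNReal.ofReal (f x * f y * heatKernel s (x - y)) =
      ∫⁻ x, ∫⁻ y, ∫⁻ s in Ioi (0 : ℝ), ENNReal.ofReal (f x * f y * heatKernel s (x - y)) := by
    -- swap `s` with `x`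
    have hm1 : Measurable fun q : ℝ × EuclideanSpace ℝ (Fin 3) =>
        ∫⁻ y, ENNReal.ofReal (f q.2 * f y * heatKernel q.1 (q.2 - y)) := by
      refine Measurable.lintegral_prod_right' (f := fun r : (ℝ × EuclideanSpace ℝ (Fin 3)) × EuclideanSpace ℝ (Fin 3) =>
        ENNReal.ofReal (f r.1.2 * f r.2 * heatKernel r.1.1 (r.1.2 - r.2))) ?_
      exact hJ.comp ((measurable_fst.comp measurable_fst).prodMk ((measurable_snd.comp measurable_fst).prodMk measurable_snd))
    rw [lintegral_lintegral_swap hm1.aemeasurable]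
    refine lintegral_congr fun x => ?_
    -- swap `s` with `y`
    have hm2 : Measurable fun q : ℝ × EuclideanSpace ℝ (Fin 3) =>
        ENNReal.ofReal (f x * f q.2 * heatKernel q.1 (x - q.2)) :=
      hJ.comp (measurable_fst.prodMk (measurable_const.prodMk measurable_snd))
    rw [lintegral_lintegral_swap hm2.aemeasurable]
  have step5 : ∀ x, ∫⁻ y, ∫⁻ s in Ioi (0 : ℝ), ENNReal.ofReal (f x * f y * heatKernel s (x - y)) =
      ∫⁻ y, ENNReal.ofReal (f x * f y * (4 * π * ‖x - y‖)⁻¹) := by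
    intro x
    have haex : ∀ᵐ y ∂(volume : Measure (EuclideanSpace ℝ (Fin 3))), y ≠ x := by
      have : (volume : Measure (EuclideanSpace ℝ (Fin 3))) {y | ¬y ≠ x} = 0 := by
        simp only [ne_eq, not_not, setOf_eq_eq_singleton, measure_singleton]
      exact ae_iff.2 this
    refine lintegral_congr_ae ?_
    filter_upwards [haex] with y hy
    have hxy : x - y ≠ 0 := sub_ne_zero.2 (Ne.symm hy)
    have h1 : ∀ s, ENNReal.ofReal (f x * f y * heatKernel s (x - y)) =
        ENNReal.ofReal (f x * f y) * ENNReal.ofReal (heatKernel s (x - y)) := fun s =>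
      ENNReal.ofReal_mul (mul_nonneg (hf0 x) (hf0 y))
    simp_rw [h1]
    rw [lintegral_const_mul' _ _ ENNReal.ofReal_ne_top, lintegral_Ioi_heatKernel hxy,
      ← ENNReal.ofReal_mul (mul_nonneg (hf0 x) (hf0 y))]
  rw [step1, step2, setLIntegral_congr_fun measurableSet_Ioi step3, step4]
  exact lintegral_congr fun x => step5 x

end Coulomb


end Literature.MathematicalPhysics.QuantumManyBody.BoseGas

end
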